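import Summits.CriticalPhenomena.CardyFormulaZ2.Theorems.CardyIKTransportIKLinearTransportWallDominationPlanarDefs

/-!
# `CardyIKTransport.IKLinearTransport` (stmt-CriticalPhenomena-5076), line `pinned-diagram-exchange`, lead c8 wave 3 —
# WALL DOMINATION, planar transfer: the box reading sees the thin-ring event and the margin crossings

Support file (`--supports stmt-CriticalPhenomena-5076`) proving the two registered sub-goals
`stub_thinRingQ_planar : ThinRingQ_planar` and `stub_marginQ_planar : MarginQ_planar` of `…WallDominationPlanarDefs`.

THE POINT.  For a planar observable configuration `x`, the observables `y := CylPlane.obsQ (boxReadQ w h x)` of its box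
reading AGREE WITH `x` ON THE BOX: a cell `v` with `0 ≤ v 0 ≤ w`, `0 ≤ v 1 ≤ h` is black in `y` iff it is black in `x`
(`boxRead_fst`), and an inner face `f` (`0 ≤ f 0 < w`, `0 ≤ f 1 < h`) carries the anti-diagonal in `y` iff it does in `x`
(`boxRead_snd`).  An edge clause of the triangulation `cellGraph` / of the open edges `blackEdges` between two cells of the
box reads, besides the two colours, only the flag of a face whose four corners are cells of the box, i.e. an inner face
(`clause_congr`, the pattern of `CylPlane.tb_congr_inner`); hence adjacency and open edges between box cells agree
(`adj_congr`, `blackEdges_congr`), black paths inside a region of the box agree (`blackPathIn_congr`, chains transferred by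
`List.IsChain.iff_of_mem_imp`), the thin-ring event — black paths inside the left/right parts of the band box, chained —
agrees (`thinRingObs_congr`), and so does every bottom–top crossing of a sub-box (`tbCross_congr`, through
`mem_openCrossing_congr`).  The two registered identities are the instances "band box at the origin" (`s + s` face
columns, `2M + 3s` rows) of these congruences.
-/

noncomputable section

namespace Summit.CriticalPhenomena.CardyFormulaZ2.Theorems.IKLinearTransport.PinnedDiagramExchange.WallDomination

open scoped BigOperators Classical
open Literature.Probability.Percolation (openCrossing Contour.site_ext)
open Literature.Probability.LatticeModels (Site)
open Summit.CriticalPhenomena.CardyFormulaZ2.Theorems.IKLinearTransport.PinnedDiagramExchange (Obs cellGraph blackEdges tbCross)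
open Summit.CriticalPhenomena.CardyFormulaZ2.Theorems.IKLinearTransport.PinnedDiagramExchange.CouplingToLimits
  (mk_mem_blackEdges_iff)
open Summit.CriticalPhenomena.CardyFormulaZ2.Cruxes.IKMixedBoxCrossing.PairedMirrorExploration.StubPatternLocality
  (mem_openCrossing_congr)
open Summit.CriticalPhenomena.CardyFormulaZ2.Cruxes.IKMixedBoxCrossing.DefectClosureExploration
open CylPlane (obsQ site_mem_obsQ_fst site_mem_obsQ_snd)
open BridgeLawStub (site site_apply_zero site_apply_one exists_site_eq)

namespace BoxPlanarStub

/-! ## §1 Edge clauses between cells of a box only read inner faces -/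

section Congr

variable {x y : Obs} {m n : ℤ}

/-- One orientation of the edge clauses (shared by `cellGraph` and `blackEdges`) between two cells `p`, `q` of the box
`[0, m) × [0, n)`: the only faces read are `p` (main diagonal, then `p + (1,1) = q` is in the box) and `p + (0,-1)`
(anti-diagonal, then `p + (1,-1) = q` is in the box), both INNER faces of the box. -/
theorem clause_congr (h2 : ∀ f : Site 2, 0 ≤ f 0 → f 0 + 1 < m → 0 ≤ f 1 → f 1 + 1 < n → (f ∈ x.2 ↔ f ∈ y.2))
    {p q : Site 2} (hp : 0 ≤ p 0 ∧ p 0 < m ∧ 0 ≤ p 1 ∧ p 1 < n) (hq : 0 ≤ q 0 ∧ q 0 < m ∧ 0 ≤ q 1 ∧ q 1 < n) :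
    (q = p + ![1, 0] ∨ q = p + ![0, 1] ∨ (q = p + ![1, 1] ∧ ¬ p ∈ x.2) ∨ (q = p + ![1, -1] ∧ (p + ![0, -1]) ∈ x.2)) ↔
      (q = p + ![1, 0] ∨ q = p + ![0, 1] ∨ (q = p + ![1, 1] ∧ ¬ p ∈ y.2) ∨
        (q = p + ![1, -1] ∧ (p + ![0, -1]) ∈ y.2)) := by
  have hd1 : q = p + ![1, 1] → (p ∈ x.2 ↔ p ∈ y.2) := fun hqp => by
    subst hqp
    simp only [Pi.add_apply, Matrix.cons_val_zero, Matrix.cons_val_one] at hq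
    exact h2 p hp.1 hq.2.1 hp.2.2.1 hq.2.2.2
  have hd2 : q = p + ![1, -1] → ((p + ![0, -1]) ∈ x.2 ↔ (p + ![0, -1]) ∈ y.2) := fun hqp => by
    subst hqp
    simp only [Pi.add_apply, Matrix.cons_val_zero, Matrix.cons_val_one] at hq
    refine h2 _ ?_ ?_ ?_ ?_ <;> simp only [Pi.add_apply, Matrix.cons_val_zero, Matrix.cons_val_one] <;> omega
  exact or_congr_right (or_congr_right (or_congr (and_congr_right fun h => not_congr (hd1 h)) (and_congr_right hd2)))

/-- Adjacency in the triangulation between two cells of the box `[0, m) × [0, n)` only reads inner faces. -/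
theorem adj_congr (h2 : ∀ f : Site 2, 0 ≤ f 0 → f 0 + 1 < m → 0 ≤ f 1 → f 1 + 1 < n → (f ∈ x.2 ↔ f ∈ y.2))
    {u v : Site 2} (hu : 0 ≤ u 0 ∧ u 0 < m ∧ 0 ≤ u 1 ∧ u 1 < n) (hv : 0 ≤ v 0 ∧ v 0 < m ∧ 0 ≤ v 1 ∧ v 1 < n) :
    (cellGraph x.2).Adj u v ↔ (cellGraph y.2).Adj u v := by
  simp only [cellGraph, SimpleGraph.fromRel_adj]
  exact and_congr_right' (or_congr (clause_congr h2 hu hv) (clause_congr h2 hv hu))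

/-- Open edges between two cells of the box `[0, m) × [0, n)` only read box cells and inner faces. -/
theorem blackEdges_congr (h1 : ∀ v : Site 2, 0 ≤ v 0 → v 0 < m → 0 ≤ v 1 → v 1 < n → (v ∈ x.1 ↔ v ∈ y.1))
    (h2 : ∀ f : Site 2, 0 ≤ f 0 → f 0 + 1 < m → 0 ≤ f 1 → f 1 + 1 < n → (f ∈ x.2 ↔ f ∈ y.2))
    {u v : Site 2} (hu : 0 ≤ u 0 ∧ u 0 < m ∧ 0 ≤ u 1 ∧ u 1 < n) (hv : 0 ≤ v 0 ∧ v 0 < m ∧ 0 ≤ v 1 ∧ v 1 < n) :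
    s(u, v) ∈ blackEdges x ↔ s(u, v) ∈ blackEdges y := by
  rw [mk_mem_blackEdges_iff, mk_mem_blackEdges_iff, h1 u hu.1 hu.2.1 hu.2.2.1 hu.2.2.2,
    h1 v hv.1 hv.2.1 hv.2.2.1 hv.2.2.2]
  exact or_congr (and_congr_right' (and_congr_right' (clause_congr h2 hu hv)))
    (and_congr_right' (and_congr_right' (clause_congr h2 hv hu)))

/-- One direction of `blackPathIn_congr`: a black path inside a region of the box is transferred. -/
theorem blackPathIn_of (h1 : ∀ v : Site 2, 0 ≤ v 0 → v 0 < m → 0 ≤ v 1 → v 1 < n → (v ∈ x.1 ↔ v ∈ y.1))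
    (h2 : ∀ f : Site 2, 0 ≤ f 0 → f 0 + 1 < m → 0 ≤ f 1 → f 1 + 1 < n → (f ∈ x.2 ↔ f ∈ y.2))
    {R : Set (Site 2)} (hR : ∀ v ∈ R, 0 ≤ v 0 ∧ v 0 < m ∧ 0 ≤ v 1 ∧ v 1 < n) {c d : Site 2}
    (H : BlackPathIn x R c d) : BlackPathIn y R c d := by
  obtain ⟨p, hc, hh, hl, hp⟩ := H
  refine ⟨p, (List.IsChain.iff_of_mem_imp fun a b ha hb => adj_congr h2 (hR a (hp a ha).2) (hR b (hp b hb).2)).1 hc,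
    hh, hl, fun v hv => ⟨?_, (hp v hv).2⟩⟩
  have hb := hR v (hp v hv).2
  exact (h1 v hb.1 hb.2.1 hb.2.2.1 hb.2.2.2).1 (hp v hv).1

/-- Black paths inside a region `R` of the box `[0, m) × [0, n)` only read box cells and inner faces. -/
theorem blackPathIn_congr (h1 : ∀ v : Site 2, 0 ≤ v 0 → v 0 < m → 0 ≤ v 1 → v 1 < n → (v ∈ x.1 ↔ v ∈ y.1))
    (h2 : ∀ f : Site 2, 0 ≤ f 0 → f 0 + 1 < m → 0 ≤ f 1 → f 1 + 1 < n → (f ∈ x.2 ↔ f ∈ y.2))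
    {R : Set (Site 2)} (hR : ∀ v ∈ R, 0 ≤ v 0 ∧ v 0 < m ∧ 0 ≤ v 1 ∧ v 1 < n) (c d : Site 2) :
    BlackPathIn x R c d ↔ BlackPathIn y R c d :=
  ⟨blackPathIn_of h1 h2 hR, blackPathIn_of (fun v e0 em e1 en => (h1 v e0 em e1 en).symm)
    (fun f e0 em e1 en => (h2 f e0 em e1 en).symm) hR⟩

/-- The thin-ring event only reads box cells and inner faces, as soon as the left and right parts of its band box lie
in the box `[0, m) × [0, n)`. -/
theorem thinRingObs_congr (h1 : ∀ v : Site 2, 0 ≤ v 0 → v 0 < m → 0 ≤ v 1 → v 1 < n → (v ∈ x.1 ↔ v ∈ y.1))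
    (h2 : ∀ f : Site 2, 0 ≤ f 0 → f 0 + 1 < m → 0 ≤ f 1 → f 1 + 1 < n → (f ∈ x.2 ↔ f ∈ y.2)) {a₀ b₀ : ℤ} {s M : ℕ}
    (hRr : ∀ v ∈ rightRegion a₀ b₀ s M, 0 ≤ v 0 ∧ v 0 < m ∧ 0 ≤ v 1 ∧ v 1 < n)
    (hRl : ∀ v ∈ leftRegion a₀ b₀ s M, 0 ≤ v 0 ∧ v 0 < m ∧ 0 ≤ v 1 ∧ v 1 < n) :
    x ∈ ThinRingObs a₀ b₀ s M ↔ y ∈ ThinRingObs a₀ b₀ s M := by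
  have hr : BlackPathIn x (rightRegion a₀ b₀ s M) = BlackPathIn y (rightRegion a₀ b₀ s M) :=
    funext fun c => funext fun d => propext (blackPathIn_congr h1 h2 hRr c d)
  have hl : BlackPathIn x (leftRegion a₀ b₀ s M) = BlackPathIn y (leftRegion a₀ b₀ s M) :=
    funext fun c => funext fun d => propext (blackPathIn_congr h1 h2 hRl c d)
  simp only [ThinRingObs, Set.mem_setOf_eq, hr, hl]

/-- Bottom–top crossings of a sub-box `[a, a+w') × [b, b+h')` of the box `[0, m) × [0, n)` only read box cells and
inner faces (`mem_openCrossing_congr`: the crossing event only reads edges between cells of the sub-box). -/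
theorem tbCross_congr (h1 : ∀ v : Site 2, 0 ≤ v 0 → v 0 < m → 0 ≤ v 1 → v 1 < n → (v ∈ x.1 ↔ v ∈ y.1))
    (h2 : ∀ f : Site 2, 0 ≤ f 0 → f 0 + 1 < m → 0 ≤ f 1 → f 1 + 1 < n → (f ∈ x.2 ↔ f ∈ y.2)) {a b : ℤ} {w' h' : ℕ}
    (ha : 0 ≤ a) (haw : a + w' ≤ m) (hb : 0 ≤ b) (hbh : b + h' ≤ n) :
    x ∈ tbCross a b w' h' ↔ y ∈ tbCross a b w' h' := by
  have key : ∀ u ∈ {v : Site 2 | a ≤ v 0 ∧ v 0 < a + w' ∧ b ≤ v 1 ∧ v 1 < b + h'},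
      ∀ v ∈ {v : Site 2 | a ≤ v 0 ∧ v 0 < a + w' ∧ b ≤ v 1 ∧ v 1 < b + h'},
        (s(u, v) ∈ blackEdges x ↔ s(u, v) ∈ blackEdges y) := fun u hu v hv => by
    simp only [Set.mem_setOf_eq] at hu hv
    exact blackEdges_congr h1 h2 ⟨by omega, by omega, by omega, by omega⟩ ⟨by omega, by omega, by omega, by omega⟩
  exact mem_openCrossing_congr key

end Congr

/-! ## §2 The observables of the box reading agree with the configuration on the box -/

variable {w h : ℕ}

/-- A cell of the box `[0, w] × [0, h]` is black in the observables of the box reading iff it is black. -/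
theorem boxRead_fst (x : Obs) : ∀ v : Site 2, 0 ≤ v 0 → v 0 < (w : ℤ) + 1 → 0 ≤ v 1 → v 1 < (h : ℤ) + 1 →
    (v ∈ (obsQ (boxReadQ w h x)).1 ↔ v ∈ x.1) := by
  intro v h0 hw h1 hh
  obtain ⟨p, rfl⟩ := exists_site_eq (k := w + 1) (l := h + 1) h0 (by push_cast; omega) h1 (by push_cast; omega)
  rw [site_mem_obsQ_fst]
  show decide (site p ∈ x.1) = true ↔ _
  rw [decide_eq_true_eq]

/-- An inner face of the box (`0 ≤ f 0 < w`, `0 ≤ f 1 < h`) carries the anti-diagonal in the observables of the box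
reading iff it does in the configuration. -/
theorem boxRead_snd (x : Obs) : ∀ f : Site 2, 0 ≤ f 0 → f 0 + 1 < (w : ℤ) + 1 → 0 ≤ f 1 → f 1 + 1 < (h : ℤ) + 1 →
    (f ∈ (obsQ (boxReadQ w h x)).2 ↔ f ∈ x.2) := by
  intro f h0 hw h1 hh
  obtain ⟨p, rfl⟩ := exists_site_eq (k := w) (l := h) h0 (by omega) h1 (by omega)
  rw [show site p = site ((p.1.castSucc : Fin (w + 1)), (p.2.castSucc : Fin (h + 1))) from
    Contour.site_ext (by simp) (by simp), site_mem_obsQ_snd]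
  show decide (site ((p.1.castSucc : Fin (w + 1)), (p.2.castSucc : Fin (h + 1))) ∈ x.2) = true ↔ _
  rw [decide_eq_true_eq]

end BoxPlanarStub

open BoxPlanarStub in
/-- **PLANAR SIDE, THIN RING** (registered sub-goal `stub_thinRingQ_planar`): the planar configurations whose band-box
reading lies in `ThinRingQ s M` are exactly those of `ThinRingObs 0 0 s M` — the black paths of the event live in the
left/right parts of the band box `[0, 2s] × [0, 2M+3s)`, where the observables of the box reading agree with the
configuration (cells) and with its triangulation (inner faces). -/
theorem stub_thinRingQ_planar : ThinRingQ_planar := by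
  intro s M hs
  refine Set.ext fun x => ?_
  show obsQ (boxReadQ (s + s) (2 * M + 3 * s - 1) x) ∈ ThinRingObs 0 0 s M ↔ x ∈ ThinRingObs 0 0 s M
  refine thinRingObs_congr (boxRead_fst x) (boxRead_snd x) (fun v hv => ?_) (fun v hv => ?_)
  · simp only [rightRegion, Set.mem_setOf_eq] at hv
    push_cast at hv ⊢
    omega
  · simp only [leftRegion, Set.mem_setOf_eq] at hv
    push_cast at hv ⊢
    omega

open BoxPlanarStub in
/-- **PLANAR SIDE, MARGINS** (registered sub-goal `stub_marginQ_planar`): the planar configurations whose band-box reading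
lies in `MarginQ s M i` are exactly the bottom–top crossings of the `i`-th margin box, a sub-box of the band box, on which
the open edges of the observables of the box reading are those of the configuration. -/
theorem stub_marginQ_planar : MarginQ_planar := by
  intro s M hs i
  refine Set.ext fun x => ?_
  show obsQ (boxReadQ (s + s) (2 * M + 3 * s - 1) x) ∈ tbCross (marginCorner s M i).1 (marginCorner s M i).2 (s + 1) M ↔
    x ∈ tbCross (marginCorner s M i).1 (marginCorner s M i).2 (s + 1) M
  have hc : (0 ≤ (marginCorner s M i).1 ∧ (marginCorner s M i).1 + ((s + 1 : ℕ) : ℤ) ≤ ((s + s : ℕ) : ℤ) + 1) ∧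
      (0 ≤ (marginCorner s M i).2 ∧ (marginCorner s M i).2 + (M : ℤ) ≤ ((2 * M + 3 * s - 1 : ℕ) : ℤ) + 1) := by
    fin_cases i <;> simp [marginCorner] <;> omega
  exact tbCross_congr (boxRead_fst x) (boxRead_snd x) hc.1.1 hc.1.2 hc.2.1 hc.2.2

end Summit.CriticalPhenomena.CardyFormulaZ2.Theorems.IKLinearTransport.PinnedDiagramExchange.WallDomination

end
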